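import Summits.CriticalPhenomena.CardyFormulaZ2.Theses.CardyWickAnisotropy
import Summits.CriticalPhenomena.CardyFormulaZ2.Theorems.CardyWickAnisotropySelfDualityBookkeeping
import Literature.Probability.Percolation.LatticeSymmetry

/-!
# `SelfDuality` (stmt-CriticalPhenomena-10259) — route `CardyWickAnisotropy`, sub-problem `CardyFormulaZ2`

The support item `Summit.CriticalPhenomena.CardyFormulaZ2.Theses.CardyWickAnisotropy.SelfDuality`:
for every `n` and every COMPLEX `p`, the anisotropic crossing amplitude
`V_n(p) = Σ_{ω ⊆ E(R_n)} 1[ω ∈ LR(R_n)] Π_{e ∈ E(R_n)} (w_p(e) if e ∈ ω else 1 - w_p(e))` of the box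
`R_n = [0, n + 1] × [0, n]` (`w_p = p` on horizontal and `1 - p` on vertical edges) satisfies
`V_n(p) + V_n(1 - p) = 1` (`cardyWickAnisotropy_selfDuality_proof`).

Proof (Bollobás–Riordan 2006, Ch. 3, Lemma 1 and Corollary 3; Grimmett 1999, §11.2, Lemma 11.21),
as an exact finite identity (no probability, no polynomial continuation): the bookkeeping lemma
`sum_ite_prod_add_of_involution` and the edge involution `τ` of `tau_spec`
(`CardyWickAnisotropySelfDualityBookkeeping.lean`), fed with the crossing flip
`filter_mem_lrCrossing_iff` — `{e ∈ E | τ e ∉ ω} ∈ LR ↔ ω ∉ LR` — proved here from planar duality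
`lrCrossing_xor_dualTBCrossing_holds` (`PlanarDuality.lean`), transport of crossing events along
the quarter turn (`preimage_relabel_openCrossing`, `LatticeSymmetry.lean`), and locality of
crossing events (`PlanarDuality.determinedBy_openCrossing`) applied once to `R_n` and once to the
dual rectangle (this is where the boundary-column edges drop out). No definitions are declared.
-/

noncomputable section

open Literature.Probability.Percolation
open Literature.Probability.LatticeModels

namespace Summit.CriticalPhenomena.CardyFormulaZ2.Theorems.CardyWickAnisotropy

/-! ### Crossing events: locality, duality, transport -/

/-- Left-right crossings of the box only depend on the edges of the box: lattice configurations
agreeing on `E` agree on `LR`. (`PlanarDuality.determinedBy_openCrossing`.) -/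
theorem mem_lrCrossing_congr_of_agree (n : ℕ) (E : Finset (Sym2 (Site 2)))
    (hE : ∀ e, e ∈ E ↔ e ∈ (zdGraph 2).edgeSet ∧ ∀ z ∈ e, z ∈ rectangle (n + 1) n)
    {ω₁ ω₂ : Set (Sym2 (Site 2))} (h₁ : ω₁ ⊆ (zdGraph 2).edgeSet) (h₂ : ω₂ ⊆ (zdGraph 2).edgeSet)
    (h : ∀ e ∈ E, (e ∈ ω₁ ↔ e ∈ ω₂)) :
    ω₁ ∈ lrCrossing (n + 1) n ↔ ω₂ ∈ lrCrossing (n + 1) n := by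
  have hd := PlanarDuality.determinedBy_openCrossing (rectangle (n + 1) n)
    (↑(leftSide (n + 1) n) : Set (Site 2)) ↑(rightSide (n + 1) n)
  rw [determinedBy_iff] at hd
  refine hd ω₁ ω₂ ?_
  ext e
  simp only [Set.mem_inter_iff, Finset.mem_coe, Finset.mem_sym2_iff]
  constructor
  · rintro ⟨he, hR⟩
    exact ⟨(h e ((hE e).2 ⟨h₁ he, hR⟩)).1 he, hR⟩
  · rintro ⟨he, hR⟩
    exact ⟨(h e ((hE e).2 ⟨h₂ he, hR⟩)).2 he, hR⟩

/-- **The boundary columns drop out.** Two configurations carried by the edges of the box which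
agree on every edge whose dual lies in the dual rectangle agree on `LR`: by planar duality
(`lrCrossing_xor_dualTBCrossing_holds`) `LR` is the complement of the dual top-bottom crossing,
which only depends on the dual edges inside the dual rectangle. -/
theorem mem_lrCrossing_congr_of_agree_dual (n : ℕ) (E : Finset (Sym2 (Site 2)))
    (hE : ∀ e, e ∈ E ↔ e ∈ (zdGraph 2).edgeSet ∧ ∀ z ∈ e, z ∈ rectangle (n + 1) n)
    {ω₁ ω₂ : Set (Sym2 (Site 2))} (h₁ : ω₁ ⊆ ↑E) (h₂ : ω₂ ⊆ ↑E)
    (h : ∀ e ∈ E, dualEdge e ∈ (dualRectangle (n + 1) n).sym2 → (e ∈ ω₁ ↔ e ∈ ω₂)) :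
    ω₁ ∈ lrCrossing (n + 1) n ↔ ω₂ ∈ lrCrossing (n + 1) n := by
  have hE' : (↑E : Set (Sym2 (Site 2))) ⊆ (zdGraph 2).edgeSet :=
    fun e he => ((hE e).1 (Finset.mem_coe.1 he)).1
  have x₁ := lrCrossing_xor_dualTBCrossing_holds (n + 1) n (h₁.trans hE')
  have x₂ := lrCrossing_xor_dualTBCrossing_holds (n + 1) n (h₂.trans hE')
  suffices hs : ω₁ ∈ dualTBCrossing (n + 1) n ↔ ω₂ ∈ dualTBCrossing (n + 1) n by
    rcases x₁ with ⟨a, b⟩ | ⟨a, b⟩ <;> rcases x₂ with ⟨c, d⟩ | ⟨c, d⟩ <;> tauto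
  have hd := PlanarDuality.determinedBy_openCrossing (dualRectangle (n + 1) n)
    (↑(dualTopSide (n + 1) n) : Set (Site 2)) ↑(dualBottomSide (n + 1) n)
  rw [determinedBy_iff] at hd
  refine hd (dualConfig ω₁) (dualConfig ω₂) ?_
  ext e'
  simp only [Set.mem_inter_iff, Finset.mem_coe, mem_dualConfig_iff]
  constructor
  · rintro ⟨⟨he', hne⟩, hR⟩
    refine ⟨⟨he', fun e he hde => ?_⟩, hR⟩
    have heE : e ∈ E := Finset.mem_coe.1 (h₂ he)
    exact hne e ((h e heE (by rw [hde]; exact hR)).2 he) hde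
  · rintro ⟨⟨he', hne⟩, hR⟩
    refine ⟨⟨he', fun e he hde => ?_⟩, hR⟩
    have heE : e ∈ E := Finset.mem_coe.1 (h₁ he)
    exact hne e ((h e heE (by rw [hde]; exact hR)).1 he) hde

/-- The quarter turn `ψ (x₀, x₁) = (x₁ + 1, x₀)` carries a finite set `S` onto `T` as soon as
`z ∈ T ↔ (z₁, z₀ - 1) ∈ S`. -/
theorem image_quarterTurn_eq (ψ : Site 2 ≃ Site 2) (hψ0 : ∀ x, ψ x 0 = x 1 + 1) (hψ1 : ∀ x, ψ x 1 = x 0)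
    (S T : Finset (Site 2)) (hST : ∀ z : Site 2, z ∈ T ↔ (![z 1, z 0 - 1] : Site 2) ∈ S) :
    ψ '' (↑S : Set (Site 2)) = ↑T := by
  ext z
  simp only [Set.mem_image, Finset.mem_coe]
  constructor
  · rintro ⟨x, hx, rfl⟩
    rw [hST]
    convert hx using 1
    rw [Site.eq_iff_two]; simp [hψ0, hψ1]
  · intro hz
    refine ⟨_, (hST z).1 hz, ?_⟩
    rw [Site.eq_iff_two]; simp [hψ0, hψ1]

/-- **Duality + quarter turn.** A lattice configuration has NO left-right crossing of
`[0, n + 1] × [0, n]` iff the quarter turn of its dual configuration has one: planar duality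
(`lrCrossing_xor_dualTBCrossing_holds`) and transport of the dual top-bottom crossing of the dual
rectangle `[0, n] × [-1, n]` along `ψ` (`preimage_relabel_openCrossing`), which maps the dual
rectangle onto the box, its top side onto the right side and its bottom side onto the left side. -/
theorem not_mem_lrCrossing_iff_relabel_dualConfig (n : ℕ) (ψ : Site 2 ≃ Site 2)
    (hψ0 : ∀ x, ψ x 0 = x 1 + 1) (hψ1 : ∀ x, ψ x 1 = x 0)
    {ω : Set (Sym2 (Site 2))} (hω : ω ⊆ (zdGraph 2).edgeSet) :
    ω ∉ lrCrossing (n + 1) n ↔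
      BondConfig.relabel (sym2Equiv ψ) (dualConfig ω) ∈ lrCrossing (n + 1) n := by
  have hx := lrCrossing_xor_dualTBCrossing_holds (n + 1) n hω
  have h1 : ω ∉ lrCrossing (n + 1) n ↔ ω ∈ dualTBCrossing (n + 1) n := by
    rcases hx with ⟨a, b⟩ | ⟨a, b⟩ <;> tauto
  rw [h1, dualTBCrossing, Set.mem_preimage]
  have key := Set.ext_iff.1 (preimage_relabel_openCrossing ψ (↑(dualRectangle (n + 1) n) : Set (Site 2))
    ↑(dualTopSide (n + 1) n) ↑(dualBottomSide (n + 1) n)) (dualConfig ω)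
  rw [← key, Set.mem_preimage,
    image_quarterTurn_eq ψ hψ0 hψ1 (dualRectangle (n + 1) n) (rectangle (n + 1) n) (fun z => by
      rw [mem_rectangle_iff, mem_dualRectangle_iff]
      simp only [Matrix.cons_val_zero, Matrix.cons_val_one]
      push_cast; omega),
    image_quarterTurn_eq ψ hψ0 hψ1 (dualTopSide (n + 1) n) (rightSide (n + 1) n) (fun z => by
      rw [rightSide, dualTopSide, Finset.mem_filter, Finset.mem_filter, mem_rectangle_iff,
        mem_dualRectangle_iff]
      simp only [Matrix.cons_val_zero, Matrix.cons_val_one]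
      push_cast; omega),
    image_quarterTurn_eq ψ hψ0 hψ1 (dualBottomSide (n + 1) n) (leftSide (n + 1) n) (fun z => by
      rw [leftSide, dualBottomSide, Finset.mem_filter, Finset.mem_filter, mem_rectangle_iff,
        mem_dualRectangle_iff]
      simp only [Matrix.cons_val_zero, Matrix.cons_val_one]
      push_cast; omega),
    lrCrossing, mem_openCrossing_iff, mem_openCrossing_iff]
  constructor <;> rintro ⟨x, hx, y, hy, h⟩ <;> exact ⟨y, hy, x, hx, by rw [openConnIn_comm]; exact h⟩

/-- The quarter turn of the dual configuration, read on an edge `e` of the box whose dual lies in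
the dual rectangle: it is open there iff `τ e` is closed. -/
theorem mem_relabel_dualConfig_iff (n : ℕ) (ψ : Site 2 ≃ Site 2)
    (τ : Sym2 (Site 2) → Sym2 (Site 2))
    (hτ : ∀ e, τ e = if dualEdge e ∈ (dualRectangle (n + 1) n).sym2 then Sym2.map ψ (dualEdge e) else e)
    (E : Finset (Sym2 (Site 2)))
    (hE : ∀ e, e ∈ E ↔ e ∈ (zdGraph 2).edgeSet ∧ ∀ z ∈ e, z ∈ rectangle (n + 1) n)
    (hspec : ∀ e ∈ E, τ e ∈ E ∧ τ (τ e) = e ∧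
      (dualEdge e ∈ (dualRectangle (n + 1) n).sym2 → dualEdge (τ e) ∈ (dualRectangle (n + 1) n).sym2))
    (ω : Finset (Sym2 (Site 2))) {e : Sym2 (Site 2)} (he : e ∈ E)
    (hde : dualEdge e ∈ (dualRectangle (n + 1) n).sym2) :
    e ∈ BondConfig.relabel (sym2Equiv ψ) (dualConfig ↑ω) ↔ τ e ∉ ω := by
  obtain ⟨hτe, hττ, hdτ⟩ := hspec e he
  have hkey : (sym2Equiv ψ).symm e = dualEdge (τ e) := by
    rw [Equiv.symm_apply_eq, sym2Equiv_apply]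
    have h := hτ (τ e)
    rw [if_pos (hdτ hde), hττ] at h
    exact h
  rw [BondConfig.mem_relabel_iff, hkey, mem_dualConfig_iff]
  constructor
  · rintro ⟨-, hne⟩ hmem
    exact hne (τ e) (Finset.mem_coe.2 hmem) rfl
  · intro hnot
    refine ⟨dualEdge_mem_edgeSet_holds ((hE _).1 hτe).1, fun e' he' hde' => ?_⟩
    have : e' = τ e := dualEdge_bijective.1 hde'
    exact hnot (this ▸ Finset.mem_coe.1 he')

/-- **The configuration involution exchanges `LR` with its complement**: for `ω ⊆ E`,
`{e ∈ E | τ e ∉ ω} ∈ LR ↔ ω ∉ LR`. -/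
theorem filter_mem_lrCrossing_iff (n : ℕ) (ψ : Site 2 ≃ Site 2)
    (hψ0 : ∀ x, ψ x 0 = x 1 + 1) (hψ1 : ∀ x, ψ x 1 = x 0)
    (hψE : ∀ z, z ∈ (zdGraph 2).edgeSet → Sym2.map ψ z ∈ (zdGraph 2).edgeSet)
    (τ : Sym2 (Site 2) → Sym2 (Site 2))
    (hτ : ∀ e, τ e = if dualEdge e ∈ (dualRectangle (n + 1) n).sym2 then Sym2.map ψ (dualEdge e) else e)
    (E : Finset (Sym2 (Site 2)))
    (hE : ∀ e, e ∈ E ↔ e ∈ (zdGraph 2).edgeSet ∧ ∀ z ∈ e, z ∈ rectangle (n + 1) n)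
    (hspec : ∀ e ∈ E, τ e ∈ E ∧ τ (τ e) = e ∧
      (dualEdge e ∈ (dualRectangle (n + 1) n).sym2 → dualEdge (τ e) ∈ (dualRectangle (n + 1) n).sym2))
    (ω : Finset (Sym2 (Site 2))) (hω : ω ⊆ E) :
    (↑(E.filter fun e => τ e ∉ ω) : Set (Sym2 (Site 2))) ∈ lrCrossing (n + 1) n ↔
      ¬ (↑ω : Set (Sym2 (Site 2))) ∈ lrCrossing (n + 1) n := by
  have hE' : (↑E : Set (Sym2 (Site 2))) ⊆ (zdGraph 2).edgeSet :=
    fun e he => ((hE e).1 (Finset.mem_coe.1 he)).1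
  set D : Set (Sym2 (Site 2)) := BondConfig.relabel (sym2Equiv ψ) (dualConfig ↑ω) with hD
  have hDsub : D ⊆ (zdGraph 2).edgeSet := by
    intro e he
    rw [hD, BondConfig.mem_relabel_iff] at he
    have h1 := hψE _ (mem_dualConfig_iff.1 he).1
    rwa [← sym2Equiv_apply, Equiv.apply_symm_apply] at h1
  -- step 1: the boundary columns drop out
  have step1 : (↑(E.filter fun e => τ e ∉ ω) : Set (Sym2 (Site 2))) ∈ lrCrossing (n + 1) n ↔
      D ∩ ↑E ∈ lrCrossing (n + 1) n := by
    refine mem_lrCrossing_congr_of_agree_dual n E hE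
      (Finset.coe_subset.2 (Finset.filter_subset _ _)) Set.inter_subset_right fun e he hde => ?_
    rw [Finset.mem_coe, Finset.mem_filter, Set.mem_inter_iff, Finset.mem_coe,
      mem_relabel_dualConfig_iff n ψ τ hτ E hE hspec ω he hde]
    tauto
  -- step 2: locality on the box
  have step2 : D ∩ ↑E ∈ lrCrossing (n + 1) n ↔ D ∈ lrCrossing (n + 1) n :=
    mem_lrCrossing_congr_of_agree n E hE (Set.inter_subset_left.trans hDsub) hDsub
      fun e he => by simp [he]
  -- step 3: duality + quarter turn
  rw [step1, step2, hD]
  exact (not_mem_lrCrossing_iff_relabel_dualConfig n ψ hψ0 hψ1 ((Finset.coe_subset.2 hω).trans hE')).symm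

/-! ### The item -/

open Classical in
/-- **`SelfDuality`** (item stmt-CriticalPhenomena-10259 of route `CardyWickAnisotropy`): for
every `n` and every complex `p`, `V_n(p) + V_n(1 - p) = 1` for the complex-anisotropy crossing
amplitude `V_n(p) = Σ_{ω ⊆ E(R_n)} 1[ω ∈ LR(R_n)] Π_e (w_p(e) if e ∈ ω else 1 - w_p(e))` of the
box `R_n = [0, n + 1] × [0, n]`, `w_p = p` on horizontal and `1 - p` on vertical edges.
Proof: `sum_ite_prod_add_of_involution` with the edge involution `τ` of `tau_spec` and the
crossing flip `filter_mem_lrCrossing_iff` (planar duality and the quarter turn carrying the dual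
box onto the box with the two edge types exchanged). In particular `V_n(½) = ½`.
(Bollobás–Riordan 2006, Ch. 3, Lemma 1 and Corollary 3; Grimmett 1999, Lemma 11.21.) -/
theorem _root_.Summit.CriticalPhenomena.CardyFormulaZ2.Theorems.cardyWickAnisotropy_selfDuality_proof :
    Summit.CriticalPhenomena.CardyFormulaZ2.Theses.CardyWickAnisotropy.SelfDuality := by
  unfold Summit.CriticalPhenomena.CardyFormulaZ2.Theses.CardyWickAnisotropy.SelfDuality
  intro E w V n p
  -- the quarter turn
  have hψ0 : ∀ x : Site 2, (transposeIso.trans (zdShiftIso ![1, 0])).toEquiv x 0 = x 1 + 1 :=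
    fun x => by simp
  have hψ1 : ∀ x : Site 2, (transposeIso.trans (zdShiftIso ![1, 0])).toEquiv x 1 = x 0 :=
    fun x => by simp
  have hψE : ∀ z, z ∈ (zdGraph 2).edgeSet →
      Sym2.map (transposeIso.trans (zdShiftIso ![1, 0])).toEquiv z ∈ (zdGraph 2).edgeSet :=
    fun z hz => (sym2Equiv_mem_edgeSet_iff (transposeIso.trans (zdShiftIso ![1, 0])) z).2 hz
  -- the edges of the box
  have hE : ∀ e, e ∈ E n ↔ e ∈ (zdGraph 2).edgeSet ∧ ∀ z ∈ e, z ∈ rectangle (n + 1) n := by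
    intro e
    induction e using Sym2.ind with
    | h x y =>
      simp only [E, Finset.mem_image, Finset.mem_filter, Finset.mem_product, SimpleGraph.mem_edgeSet,
        Prod.exists]
      constructor
      · rintro ⟨a, b, ⟨⟨ha, hb⟩, hadj⟩, hab⟩
        refine ⟨?_, fun z hz => ?_⟩
        · rw [← SimpleGraph.mem_edgeSet, ← hab, SimpleGraph.mem_edgeSet]
          exact hadj
        · rw [← hab] at hz
          rcases Sym2.mem_iff.1 hz with rfl | rfl
          · exact ha
          · exact hb
      · rintro ⟨hadj, hz⟩
        exact ⟨x, y, ⟨⟨hz x (Sym2.mem_mk_left _ _), hz y (Sym2.mem_mk_right _ _)⟩, hadj⟩, rfl⟩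
  have hspec := tau_spec n (transposeIso.trans (zdShiftIso ![1, 0])).toEquiv hψ0 hψ1
    (fun e => if dualEdge e ∈ (dualRectangle (n + 1) n).sym2 then
      Sym2.map (transposeIso.trans (zdShiftIso ![1, 0])).toEquiv (dualEdge e) else e)
    (fun e => rfl) (E n) hE (fun e => ∃ x y : Site 2, e = s(x, y) ∧ x 1 = y 1) exists_eq_mk_and_iff
  exact sum_ite_prod_add_of_involution (E n) _ (fun e he => (hspec e he).1)
    (fun e he => (hspec e he).2.1) (fun e => ∃ x y : Site 2, e = s(x, y) ∧ x 1 = y 1)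
    (fun e he => (hspec e he).2.2.1)
    (fun ω => (↑ω : Set (Sym2 (Site 2))) ∈ lrCrossing (n + 1) n)
    (fun ω hω => filter_mem_lrCrossing_iff n _ hψ0 hψ1 hψE _ (fun e => rfl) (E n) hE
      (fun e he => ⟨(hspec e he).1, (hspec e he).2.1, (hspec e he).2.2.2⟩) ω hω)
    w (fun q e => rfl) (V n) (fun q => rfl) p

end Summit.CriticalPhenomena.CardyFormulaZ2.Theorems.CardyWickAnisotropy
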